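import Summits.AtomisticToContinuum.HydrodynamicLimit.Theorems.LambertianContactSwapContactAngleEquidistributionLambertWeightedMoment
import Summits.AtomisticToContinuum.HydrodynamicLimit.Theorems.LambertianContactSwapContactAngleEquidistributionLambertMixedMoment
import Summits.AtomisticToContinuum.HydrodynamicLimit.Theorems.LambertianContactSwapContactAngleEquidistributionPsiTLipschitz
import Mathlib.Analysis.InnerProductSpace.Trace
import Mathlib.Analysis.InnerProductSpace.Adjoint
import HarnessLib

/-!
# The cosine-law mean of the collisional change of a quadratic velocity observable

Crux `Summit.AtomisticToContinuum.HydrodynamicLimit.Theses.LambertianContactSwap.ContactAngleEquidistribution`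
(stmt-AtomisticToContinuum-12097), line `Sketch`, section `KappaMean`: registered stubs
`stub_lambertWeightedQuadForm_unit` and `stub_kappaMean_Dq`.

For a unit contact normal `ω` of `ℝ³` and a standard Gaussian vector `ξ`, the Lambertian direction
`n = lambertDir ω ξ` follows the cosine law on the outgoing hemisphere, with the moments
`E[⟪a, n⟫ ⟪c, n⟫] = ¼ (⟪a, c⟫ + ⟪a, ω⟫ ⟪c, ω⟫)` (`stub_lambertMixedMoment_unit`) and
`E[⟪ω, n⟫² ⟪a, n⟫ ⟪c, n⟫] = (⟪a, c⟫ + 3 ⟪a, ω⟫ ⟪c, ω⟫)/12` (`stub_lambertWeightedMixedMoment_unit`).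
This file derives

* the weighted quadratic form `E[⟪ω, n⟫² ⟪n, T n⟫] = tr T / 12 + ⟪ω, T ω⟫ / 4` for every operator `T`
  (`stub_lambertWeightedQuadForm_unit`): expand `⟪x, T x⟫ = Σ_k ⟪b_k, x⟫ ⟪T b_k, x⟫` in an orthonormal
  basis (`kappaMean_inner_apply_eq_sum`), integrate term by term with the weighted mixed moment, and
  recognise `Σ_k ⟪b_k, T b_k⟫ = tr T` (`LinearMap.trace_eq_sum_inner`) and
  `Σ_k ⟪b_k, ω⟫ ⟪T b_k, ω⟫ = ⟪ω, T ω⟫;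
* **the `κ_g`-mean of the collisional change `Dq_T` of `⟪v, T v⟫ + ⟪w, T w⟫** in an elastic collision
  whose incoming normal follows the kinematic cosine law of `g = v − w` (`stub_kappaMean_Dq`):
  `∫ Dq_T(v, w, lambertDir(−g) ξ) dγ(ξ) = (|g|² tr T − 3 ⟪g, T g⟫)/6`. With `c = ⟪g, n⟫`,
  `Dq_T = −c ⟪g, T n⟫ − c ⟪n, T g⟫ + 2 c² ⟪n, T n⟫` (`psiT_Dq_expand`); for `g ≠ 0` put `ω = −g/|g|`, so
  `lambertDir (−g) = lambertDir ω` (`lambertDir_smul_left`) and `g = r ω`, `r = −|g|`; the three unit means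
  are `E[⟪ω, n⟫ ⟪ω, T n⟫] = E[⟪ω, n⟫ ⟪n, T ω⟫] = ½ ⟪ω, T ω⟫` (mixed moment, the first with the adjoint
  `T†`) and the weighted quadratic form, whence `r² (tr T / 6 − ½ ⟪ω, T ω⟫)`
  (`kappaMean_expanded_smul_unit`); both sides vanish at `g = 0`.

Integrability of every integrand is the generic `kappaMean_integrable_comp_lambertDir`: a continuous
function of `n = lambertDir ω ξ` is bounded on the closed unit ball, which contains `n`.

References: folklore (moments of the cosine law; C. Cercignani, R. Illner, M. Pulvirenti, *The Mathematical
Theory of Dilute Gases* (1994), App. 4.A).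
-/

noncomputable section

open MeasureTheory ProbabilityTheory Filter
open scoped RealInnerProductSpace InnerProduct

namespace Summit.AtomisticToContinuum.HydrodynamicLimit.Theorems.ContactAngleEquidistributionSketch

open Literature.MathematicalPhysics.KineticTheory

/-! ### Generic integrability against the cosine law -/

/-- A continuous function of the Lambertian direction is integrable against the standard Gaussian:
`lambertDir ω ξ` lies in the closed unit ball (`norm_lambertDir_le_one`), a compact set on which a
continuous `F` is bounded. [folklore] -/
theorem kappaMean_integrable_comp_lambertDir (ω : V3) {F : V3 → ℝ} (hF : Continuous F) :
    Integrable (fun ξ : V3 => F (lambertDir ω ξ)) (stdGaussian V3) := by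
  obtain ⟨C, hC⟩ := (isCompact_closedBall (0 : V3) 1).exists_bound_of_continuousOn hF.continuousOn
  refine Integrable.of_bound
    (hF.measurable.comp (measurable_const.lambertDir measurable_id)).aestronglyMeasurable C
    (Eventually.of_forall fun ξ => hC _ ?_)
  exact mem_closedBall_zero_iff.2 (norm_lambertDir_le_one ω ξ)

/-! ### The weighted quadratic form `E[⟪ω, n⟫² ⟪n, T n⟫]` -/

/-- Expansion of a quadratic form in an orthonormal basis: `⟪x, T x⟫ = Σ_k ⟪b_k, x⟫ ⟪T b_k, x⟫`
(`x = Σ_k ⟪b_k, x⟫ b_k`, `OrthonormalBasis.sum_repr'`, and linearity of `T`). [folklore] -/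
theorem kappaMean_inner_apply_eq_sum {ι : Type*} [Fintype ι] (b : OrthonormalBasis ι ℝ V3)
    (T : V3 →L[ℝ] V3) (x : V3) : ⟪x, T x⟫ = ∑ k, ⟪b k, x⟫ * ⟪T (b k), x⟫ := by
  have hT : T x = ∑ k, ⟪b k, x⟫ • T (b k) := by
    conv_lhs => rw [← b.sum_repr' x]
    rw [map_sum]
    simp only [map_smul]
  rw [hT, inner_sum]
  refine Finset.sum_congr rfl fun k _ => ?_
  rw [real_inner_smul_right, real_inner_comm (T (b k)) x]

/-- **Registered stub `stub_lambertWeightedQuadForm_unit`** (line `Sketch` v8b, crux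
stmt-AtomisticToContinuum-12097) — the weighted quadratic form of the cosine law: for a unit normal `ω`
and every operator `T` of `ℝ³`, `E[⟪ω, n⟫² ⟪n, T n⟫] = tr T / 12 + ⟪ω, T ω⟫ / 4` with `n = lambertDir ω ξ`.
Expand `⟪n, T n⟫ = Σ_k ⟪b_k, n⟫ ⟪T b_k, n⟫` in the standard orthonormal basis, integrate each term with
`stub_lambertWeightedMixedMoment_unit` (`= (⟪b_k, T b_k⟫ + 3 ⟪b_k, ω⟫ ⟪T b_k, ω⟫)/12`), and sum:
`Σ_k ⟪b_k, T b_k⟫ = tr T` (`LinearMap.trace_eq_sum_inner`), `Σ_k ⟪b_k, ω⟫ ⟪T b_k, ω⟫ = ⟪ω, T ω⟫`.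
[folklore] -/
theorem stub_lambertWeightedQuadForm_unit {ω : V3} (hω : ‖ω‖ = 1) (T : V3 →L[ℝ] V3) :
    ∫ ξ, ⟪ω, lambertDir ω ξ⟫ ^ 2 * ⟪lambertDir ω ξ, T (lambertDir ω ξ)⟫ ∂(stdGaussian V3) =
      12⁻¹ * LinearMap.trace ℝ V3 T.toLinearMap + 4⁻¹ * ⟪ω, T ω⟫ := by
  set b : OrthonormalBasis (Fin 3) ℝ V3 := EuclideanSpace.basisFun (Fin 3) ℝ with hb
  have hq : ∀ x : V3, ⟪x, T x⟫ = ∑ k, ⟪b k, x⟫ * ⟪T (b k), x⟫ := kappaMean_inner_apply_eq_sum b T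
  have h1 : ∀ ξ : V3, ⟪ω, lambertDir ω ξ⟫ ^ 2 * ⟪lambertDir ω ξ, T (lambertDir ω ξ)⟫ =
      ∑ k, ⟪ω, lambertDir ω ξ⟫ ^ 2 * (⟪b k, lambertDir ω ξ⟫ * ⟪T (b k), lambertDir ω ξ⟫) := fun ξ => by
    rw [hq, Finset.mul_sum]
  have hint : ∀ k : Fin 3, Integrable (fun ξ : V3 =>
      ⟪ω, lambertDir ω ξ⟫ ^ 2 * (⟪b k, lambertDir ω ξ⟫ * ⟪T (b k), lambertDir ω ξ⟫)) (stdGaussian V3) :=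
    fun k => kappaMean_integrable_comp_lambertDir ω
      (F := fun n : V3 => ⟪ω, n⟫ ^ 2 * (⟪b k, n⟫ * ⟪T (b k), n⟫)) (by fun_prop)
  simp_rw [h1]
  rw [integral_finsetSum _ fun k _ => hint k]
  simp_rw [stub_lambertWeightedMixedMoment_unit hω]
  rw [LinearMap.trace_eq_sum_inner _ b, hq ω, Finset.mul_sum, Finset.mul_sum, ← Finset.sum_add_distrib]
  refine Finset.sum_congr rfl fun k _ => ?_
  rw [ContinuousLinearMap.coe_coe]
  ring

/-! ### The `κ_g`-mean of the collisional change of `⟪v, T v⟫ + ⟪w, T w⟫` -/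

/-- First linear unit mean: for a unit normal `ω`, `E[⟪ω, n⟫ ⟪ω, T n⟫] = ½ ⟪ω, T ω⟫`
(`⟪ω, T n⟫ = ⟪T† ω, n⟫` and `stub_lambertMixedMoment_unit`: `¼ (⟪ω, T† ω⟫ + ⟪ω, ω⟫ ⟪T† ω, ω⟫)`).
[folklore] -/
theorem kappaMean_linearTerm_left {ω : V3} (hω : ‖ω‖ = 1) (T : V3 →L[ℝ] V3) :
    ∫ ξ, ⟪ω, lambertDir ω ξ⟫ * ⟪ω, T (lambertDir ω ξ)⟫ ∂(stdGaussian V3) = 2⁻¹ * ⟪ω, T ω⟫ := by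
  have h : ∀ ξ : V3, ⟪ω, T (lambertDir ω ξ)⟫ = ⟪(T†) ω, lambertDir ω ξ⟫ := fun ξ =>
    (ContinuousLinearMap.adjoint_inner_left T _ ω).symm
  simp_rw [h]
  rw [stub_lambertMixedMoment_unit hω, ContinuousLinearMap.adjoint_inner_right,
    ContinuousLinearMap.adjoint_inner_left, real_inner_self_eq_norm_sq, hω, real_inner_comm (T ω) ω]
  ring

/-- Second linear unit mean: for a unit normal `ω`, `E[⟪ω, n⟫ ⟪n, T ω⟫] = ½ ⟪ω, T ω⟫`
(`stub_lambertMixedMoment_unit` with `a = ω`, `c = T ω`). [folklore] -/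
theorem kappaMean_linearTerm_right {ω : V3} (hω : ‖ω‖ = 1) (T : V3 →L[ℝ] V3) :
    ∫ ξ, ⟪ω, lambertDir ω ξ⟫ * ⟪lambertDir ω ξ, T ω⟫ ∂(stdGaussian V3) = 2⁻¹ * ⟪ω, T ω⟫ := by
  simp_rw [real_inner_comm (T ω)]
  rw [stub_lambertMixedMoment_unit hω, real_inner_self_eq_norm_sq, hω, real_inner_comm (T ω) ω]
  ring

/-- The expanded collisional change along `g = r ω`, `ω` a unit vector, averaged over the cosine law of
`ω`: `E[−c ⟪g, T n⟫ − c ⟪n, T g⟫ + 2 c² ⟪n, T n⟫] = (|g|² tr T − 3 ⟪g, T g⟫)/6`, `c = ⟪g, n⟫`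
(homogeneity in `r`, `kappaMean_linearTerm_left`, `kappaMean_linearTerm_right`,
`stub_lambertWeightedQuadForm_unit`). [folklore] -/
theorem kappaMean_expanded_smul_unit {ω : V3} (hω : ‖ω‖ = 1) (r : ℝ) (T : V3 →L[ℝ] V3) :
    ∫ ξ, (-(⟪r • ω, lambertDir ω ξ⟫ * ⟪r • ω, T (lambertDir ω ξ)⟫) -
        ⟪r • ω, lambertDir ω ξ⟫ * ⟪lambertDir ω ξ, T (r • ω)⟫ +
        2 * ⟪r • ω, lambertDir ω ξ⟫ ^ 2 * ⟪lambertDir ω ξ, T (lambertDir ω ξ)⟫) ∂(stdGaussian V3) =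
      6⁻¹ * (‖r • ω‖ ^ 2 * LinearMap.trace ℝ V3 T.toLinearMap - 3 * ⟪r • ω, T (r • ω)⟫) := by
  have iA : Integrable (fun ξ : V3 => ⟪ω, lambertDir ω ξ⟫ * ⟪ω, T (lambertDir ω ξ)⟫) (stdGaussian V3) :=
    kappaMean_integrable_comp_lambertDir ω (F := fun n : V3 => ⟪ω, n⟫ * ⟪ω, T n⟫) (by fun_prop)
  have iB : Integrable (fun ξ : V3 => ⟪ω, lambertDir ω ξ⟫ * ⟪lambertDir ω ξ, T ω⟫) (stdGaussian V3) :=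
    kappaMean_integrable_comp_lambertDir ω (F := fun n : V3 => ⟪ω, n⟫ * ⟪n, T ω⟫) (by fun_prop)
  have iC : Integrable (fun ξ : V3 =>
      ⟪ω, lambertDir ω ξ⟫ ^ 2 * ⟪lambertDir ω ξ, T (lambertDir ω ξ)⟫) (stdGaussian V3) :=
    kappaMean_integrable_comp_lambertDir ω (F := fun n : V3 => ⟪ω, n⟫ ^ 2 * ⟪n, T n⟫) (by fun_prop)
  have iAB : Integrable (fun ξ : V3 => ⟪ω, lambertDir ω ξ⟫ * ⟪ω, T (lambertDir ω ξ)⟫ +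
      ⟪ω, lambertDir ω ξ⟫ * ⟪lambertDir ω ξ, T ω⟫) (stdGaussian V3) := iA.add iB
  have iC2 : Integrable (fun ξ : V3 =>
      2 * (⟪ω, lambertDir ω ξ⟫ ^ 2 * ⟪lambertDir ω ξ, T (lambertDir ω ξ)⟫)) (stdGaussian V3) :=
    iC.const_mul 2
  have hsplit : ∀ ξ : V3, -(⟪r • ω, lambertDir ω ξ⟫ * ⟪r • ω, T (lambertDir ω ξ)⟫) -
      ⟪r • ω, lambertDir ω ξ⟫ * ⟪lambertDir ω ξ, T (r • ω)⟫ +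
      2 * ⟪r • ω, lambertDir ω ξ⟫ ^ 2 * ⟪lambertDir ω ξ, T (lambertDir ω ξ)⟫ =
      r ^ 2 * (2 * (⟪ω, lambertDir ω ξ⟫ ^ 2 * ⟪lambertDir ω ξ, T (lambertDir ω ξ)⟫) -
        (⟪ω, lambertDir ω ξ⟫ * ⟪ω, T (lambertDir ω ξ)⟫ + ⟪ω, lambertDir ω ξ⟫ * ⟪lambertDir ω ξ, T ω⟫)) :=
    fun ξ => by
    rw [map_smul, real_inner_smul_left, real_inner_smul_left, real_inner_smul_right]
    ring
  simp_rw [hsplit]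
  rw [integral_const_mul, integral_sub iC2 iAB, integral_add iA iB, integral_const_mul,
    kappaMean_linearTerm_left hω, kappaMean_linearTerm_right hω, stub_lambertWeightedQuadForm_unit hω,
    norm_smul, hω, map_smul, real_inner_smul_left, real_inner_smul_right, mul_one, Real.norm_eq_abs,
    sq_abs]
  ring

/-- **Registered stub `stub_kappaMean_Dq`** (line `Sketch` v8b, crux stmt-AtomisticToContinuum-12097) —
**the `κ_g`-mean of the collisional change of a quadratic observable**: for every operator `T` of `ℝ³` and
incoming velocities `v, w` with `g = v − w`,
`∫ Dq_T(v, w, lambertDir(−g) ξ) dγ(ξ) = (|g|² tr T − 3 ⟪g, T g⟫)/6`, where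
`Dq_T(v, w, n) = ⟪v', T v'⟫ + ⟪w', T w'⟫ − ⟪v, T v⟫ − ⟪w, T w⟫` for the elastic reflection
`(v', w') = (v − ⟪g, n⟫ n, w + ⟪g, n⟫ n)`. Proof: `Dq_T = −c ⟪g, T n⟫ − c ⟪n, T g⟫ + 2 c² ⟪n, T n⟫`,
`c = ⟪g, n⟫` (`psiT_Dq_expand`); at `g = 0` both sides vanish; otherwise `ω = −g/|g|` is a unit vector with
`lambertDir (−g) = lambertDir ω` (`lambertDir_smul_left`), `g = (−|g|) ω`, and
`kappaMean_expanded_smul_unit` applies. [folklore] -/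
theorem stub_kappaMean_Dq (T : V3 →L[ℝ] V3) (v w : V3) :
    let refl : V3 → V3 × V3 → V3 × V3 := fun n p =>
      (p.1 - ⟪p.1 - p.2, n⟫ • n, p.2 + ⟪p.1 - p.2, n⟫ • n)
    let Dq : V3 → V3 → V3 → ℝ := fun v w n =>
      ⟪(refl n (v, w)).1, T (refl n (v, w)).1⟫ + ⟪(refl n (v, w)).2, T (refl n (v, w)).2⟫ -
        ⟪v, T v⟫ - ⟪w, T w⟫
    ∫ ξ, Dq v w (lambertDir (-(v - w)) ξ) ∂(stdGaussian V3) =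
      6⁻¹ * (‖v - w‖ ^ 2 * LinearMap.trace ℝ V3 T.toLinearMap - 3 * ⟪v - w, T (v - w)⟫) := by
  intro refl Dq
  have hD : ∀ n : V3, Dq v w n = -(⟪v - w, n⟫ * ⟪v - w, T n⟫) - ⟪v - w, n⟫ * ⟪n, T (v - w)⟫ +
      2 * ⟪v - w, n⟫ ^ 2 * ⟪n, T n⟫ := fun n => psiT_Dq_expand T v w n
  simp only [hD]
  -- abbreviate `g = v - w`
  set g : V3 := v - w with hg
  rcases eq_or_ne g 0 with h0 | h0
  · simp [h0]
  -- the unit vector `ω = -g/|g|`, `lambertDir (-g) = lambertDir ω`, `g = (-|g|) ω`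
  have hgn : 0 < ‖g‖ := norm_pos_iff.2 h0
  have hgn' : ‖-g‖ ≠ 0 := norm_ne_zero_iff.2 (neg_ne_zero.2 h0)
  set ω : V3 := ‖-g‖⁻¹ • (-g) with hω
  have hdir : ∀ ξ : V3, lambertDir (-g) ξ = lambertDir ω ξ := fun ξ =>
    (lambertDir_smul_left (inv_pos.2 (norm_pos_iff.2 (neg_ne_zero.2 h0))) (-g) ξ).symm
  have hunit : ‖ω‖ = 1 := by
    rw [hω, norm_smul, norm_inv, norm_norm, inv_mul_cancel₀ hgn']
  have hgω : (-‖g‖) • ω = g := by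
    rw [hω, norm_neg, smul_smul, smul_neg, neg_mul, mul_inv_cancel₀ hgn.ne', neg_smul, one_smul, neg_neg]
  simp_rw [hdir]
  have key := kappaMean_expanded_smul_unit hunit (-‖g‖) T
  rw [hgω] at key
  exact key

end Summit.AtomisticToContinuum.HydrodynamicLimit.Theorems.ContactAngleEquidistributionSketch

end
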